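import Summits.HodgeConjecture.HodgeConjecture.Theorems.Ring2AbelianAllSpreadFrame
import Summits.HodgeConjecture.HodgeConjecture.Theorems.Ring2AbelianAllAndreJunction
import HarnessLib

/-!
# Ring 2 · sub-cell AbelianAll — the LEAD's frame, part III: CROSS-BRANCH EDGES WITHOUT `HC_CM`
# (the pivot tier of the 2×2 grid "on-path? × CM-idle?"), and a precision to part II's header

HONEST FRAMING (page 1, verbatim): **research route conditional on HC_CM; not a corollary; Q11.4-sentence-2
already refuted in dim ≥ 3.** Sub-cell line: research route, not a corollary; conditional on HC_CM plus one named
minimal statement. Nothing below proves `HC_CM` (`Theses.RankFourFaces.CMAbelianHodge`, a BINDER only), `HC_AV`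
(`Theses.PadicSemiregularLift.HodgeAbelianVarieties`) or the item `CMToAbelian` (stmt-HodgeConjecture-16267, OPEN);
every node is an `@[conjecture]` def used as a HYPOTHESIS, and every printed input enters as a binder:
`h₂₁ : andre1996_cmAnchoredPencil` (André 1996 Lemme 6.3.1), `h₂₂ : andre1996_cmHodgeClasses_algebraicallyAnchoredPencils`
(Lemmes 6.3.2–6.3.3), `h₈ : Abdulali1994_invariantCycles_of_lefschetzStandard` (Abdulali 1994 p. 1122 / Milne 2020
Prop. 1), `hF : deligne1982_cmDenseMumfordTateFamilies` (Deligne LNM 900 Prop. 6.1), `h𝔄 :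
Andre1992_hodgeClasses_cmAbelianVariety_mem_span_pullback_weilClasses` (André 1992) — refereed Literature facts taken as
hypotheses — and the two TYPED-ONLY inputs `DA_q`, `DA_K` (`DenselyAnchoredWeilFamilies{ImaginaryQuadratic,CMField}`,
spread II: our inference from Deligne's proof of Thm. 4.8, never cited as facts). Seat `pub-hodge-ring2-typer1`
(cell LEAD), gen 9; parts I/II: `Ring2AbelianAllFrame`, `Ring2AbelianAllFrameSpreading`. Nothing of deform, spread,
andre-1/2 or weil is re-derived: their theorems are invoked BY NAME (count once).

## The grid (every node `B` of the sub-cell, granted the binders its row names; NO `HC_CM` anywhere in this table)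

|  | CM-idle (`CMIdle B`: `B → HC_AV`) | not known CM-idle |
|---|---|---|
| **on-path** (`OnPathAV B`) | PIVOTS `PivotAV B` (= `B ↔ HC_AV`): (1) `AbelianSchemeVHC`, (2) `CompactAbelianPencilVHC` [mod `h₂₁ h₂₂`: deform IV]; S_ZD `SpreadFromZariskiDenseCMPoints` [mod `hF h𝔄 DA_q DA_K`: spread II/III] | PROPER COMPLEMENTS: (3), R631, (4), (T∃) [mod `h₂₁`], CPS_CM, CPS_∃ [mod `h₂₁`], U_Z, U, H4, the item |
| **not known on-path** | STRICT DOMINATORS: `FlatSectionsAlgebraic`, `VariationalHodge`, (L∀) `AlgebraicFixedPart` [mod `h₂₁ h₂₂`], (5∀) `LefschetzBCompactPencils` [mod `h₈ h₂₁ h₂₂`: andre III] | (5) `LefschetzBCMPointedPencils`, (L) `CMFibreAlgebraicLift` (close with `HC_CM`; neither bit known) |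

The one rule of this file (§0): a CM-idle node implies every on-path node, with no `HC_CM` (`imp_of_cmIdle_of_onPathAV`).
Hence ACROSS the two branches of part II (CM-anchored PENCILS vs CM-dense MUMFORD–TATE FAMILIES), through `HC_AV`:
* pencil ⟹ Mumford–Tate, granted refereed print ONLY (`h₂₁`, `h₂₂`; for (5∀) also `h₈`): (2) ⟹ S_ZD ∧ U_Z ∧ U ∧ H4
  (§2; deform IV §D already had (2) ⟹ U, `Ring2.Deform.uniformAlgebraicityAtCMPoints_of_andre1996_of_compactAbelianPencilVHC`);
* Mumford–Tate ⟹ pencil, granted `hF`, `h𝔄` and the typed `DA_q`, `DA_K`: S_ZD ⟹ (1) ∧ (2) ∧ (3) ∧ R631 ∧ (4) ∧ CPS_CM,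
  and with `h₂₁` also (T∃) ∧ CPS_∃ (§2);
* so the pivots are pairwise equivalent WITHOUT `HC_CM` (§3: `compactAbelianPencilVHC_iff_spreadZD`; deform IV had
  `(1) ↔ (2)`, spread II had `HC_AV ↔ S_ZD`).

PRECISION to part II's header (`Ring2AbelianAllFrameSpreading`, lines "ACROSS the branches NO unconditional edge is in
the tree below (1) … the two branches meet again only modulo `HC_CM` (∧ `h₂₁` ∧ `hF`)"): correct only for edges with
NO named input and for the PROPER-COMPLEMENT tier. Granted the refereed inputs `h₂₁ ∧ h₂₂` the branches meet already
at (2) without `HC_CM`, and granted `hF ∧ h𝔄 ∧ DA_q ∧ DA_K` at S_ZD; part II's table cell "S_ZD · `CMIdle`: not known"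
is superseded by spread III (`cmIdle_spreadZD`). What REMAINS `HC_CM`-dependent is exactly the proper-complement tier:
between (3)/R631/(4)/(T∃)/CPS and U_Z/U/H4 no `HC_CM`-free edge is in the tree in either direction (only the
relativised ones, §3 `modCM_edges_of_complements`), and none is claimed. Binder counts per RING2-MAP L10.3 (ii):
pencil→MT uses 2 refereed facts (3 from (5∀)), 0 typed-only; MT→pencil uses 2 refereed facts + 2 typed-only inputs.

References (bib keys): Andre1996Motifs (§6.3, Lemmes 6.3.1–6.3.3, Remarque 2, pp. 31–33); Deligne1982HodgeCycles
(Prop. 6.1; Thm. 4.8); Andre1992HodgeCM; Abdulali1994FamiliesAV (p. 1122); Milne2020HodgeClassesAV (Prop. 1, Thm. 4);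
CharlesSchnell2014Notes (Thm. 11.5.11, Cor. 11.3.6).
-/

set_option linter.dupNamespace false

namespace Summit.HodgeConjecture.HodgeConjecture.Ring2.AbelianAll

open Literature.AlgebraicGeometry Literature.AlgebraicGeometry.Motives
open Literature.AlgebraicGeometry.HodgeTheory
open Literature.AlgebraicGeometry.Andre1996 (andre1996_cmAnchoredPencil
  andre1996_cmHodgeClasses_algebraicallyAnchoredPencils)
open Literature.AlgebraicGeometry.Abdulali1994 (Abdulali1994_invariantCycles_of_lefschetzStandard)
open Literature.AlgebraicGeometry.Deligne1982 (deligne1982_cmDenseMumfordTateFamilies)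
open Summit.HodgeConjecture.HodgeConjecture
open Summit.HodgeConjecture.HodgeConjecture.Theses
open Summit.HodgeConjecture.HodgeConjecture.Theses.RankFourFaces (CMAbelianHodge CMToAbelian)
open Summit.HodgeConjecture.HodgeConjecture.Theses.PadicSemiregularLift (HodgeAbelianVarieties)
open Summit.HodgeConjecture.HodgeConjecture.Ring2.Deform (CompactAbelianPencilVHC CMPointedCompactPencilVHC
  CMAnchoredPencilVHC CMPointedPencilCMSpreading CMAnchoredPencilCMSpreading UniformAlgebraicityAtCMPoints
  AlgebraicityLocusClosedOnCMDenseFamilies)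
open Summit.HodgeConjecture.HodgeConjecture.Ring2.Hypotheses (AbelianSchemeVHC FlatSectionsAlgebraic)

/-! ## §0 Grammar, continued (part I §0): pivots, and the cross-edge rule -/

/-- `B` is a PIVOT of the sub-cell: CM-idle AND on-path — the top-left cell of the grid. A definition. [folklore] -/
def PivotAV (B : Prop) : Prop := CMIdle B ∧ OnPathAV B

/-- A pivot is exactly a statement equivalent to `HC_AV` (granted whatever inputs the instance carries). [folklore] -/
theorem pivotAV_iff {B : Prop} : PivotAV B ↔ (B ↔ HodgeAbelianVarieties) :=
  ⟨fun h ↦ ⟨h.1, h.2⟩, fun h ↦ ⟨h.1, h.2⟩⟩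

/-- **The cross-edge rule**: a CM-idle node implies every on-path node, with NO `HC_CM` (compare part I's relativised
`modCM_of_closesWithCM_of_onPathAV`, which needs only `ClosesWithCM` but concludes `HC_CM → B'`). [folklore] -/
theorem imp_of_cmIdle_of_onPathAV {B B' : Prop} (h : CMIdle B) (h' : OnPathAV B') : B → B' :=
  fun hB ↦ h' (h hB)

/-- Two pivots are equivalent, with no `HC_CM`. [folklore] -/
theorem iff_of_pivotAV {B B' : Prop} (h : PivotAV B) (h' : PivotAV B') : B ↔ B' :=
  ⟨imp_of_cmIdle_of_onPathAV h.1 h'.2, imp_of_cmIdle_of_onPathAV h'.1 h.2⟩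

/-- A pivot is an exact complement of `HC_CM` (so, relativised, it is the item: part I `modCM_iff_cmToAbelian_of_exactWithCM`).
[folklore] -/
theorem exactWithCM_of_pivotAV {B : Prop} (h : PivotAV B) : ExactWithCM B :=
  exactWithCM_iff.2 ⟨closesWithCM_of_cmIdle h.1, h.2⟩

/-- **What the KIND column means, in the kernel**: `B` makes `HC_CM` idle iff `B` closes with `HC_CM` AND already
contains `HC_CM` (`HC_AV → HC_CM`: products of CM elliptic curves are abelian varieties, `Ring2.Deform.HC_CM_of_HC_AV`).
So "KIND 1" = "the complement proves Hodge for CM abelian varieties on its own". [folklore] -/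
theorem cmIdle_iff_closesWithCM_and_imp_HC_CM {B : Prop} : CMIdle B ↔ ClosesWithCM B ∧ (B → CMAbelianHodge) :=
  ⟨fun h ↦ ⟨closesWithCM_of_cmIdle h, fun hB ↦ Deform.HC_CM_of_HC_AV (h hB)⟩, fun h hB ↦ h.1 (h.2 hB) hB⟩

/-! ## §1 The pivot tier (instances by name; nothing re-derived) -/

/-- (1) and (2) are pivots, granted Lemmes 6.3.1–6.3.3 (deform IV `HC_AV_of_andre1996_of_compactAbelianPencilVHC` through
part I `cmIdle_blanket_of_andre1996`, and part I `onPathAV_abelianSchemeVHC_and_compactAbelianPencilVHC`).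
[cite: Andre1996Motifs, §6.3 Remarque 2 (p. 33)] [cite: Milne2020HodgeClassesAV, Thm. 4 (p. 8)] -/
theorem pivotAV_pencilTop_of_andre1996 (h₂₁ : andre1996_cmAnchoredPencil)
    (h₂₂ : andre1996_cmHodgeClasses_algebraicallyAnchoredPencils) :
    PivotAV AbelianSchemeVHC ∧ PivotAV CompactAbelianPencilVHC :=
  have h := cmIdle_blanket_of_andre1996 h₂₁ h₂₂
  ⟨⟨h.2.2.1, onPathAV_abelianSchemeVHC_and_compactAbelianPencilVHC.1⟩,
    ⟨h.2.2.2.1, onPathAV_abelianSchemeVHC_and_compactAbelianPencilVHC.2⟩⟩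

/-- S_ZD is a pivot, granted `hF`, `h𝔄`, `DA_q`, `DA_K` (spread III `cmIdle_spreadZD`, part II `onPathAV_spreadAxis`); and so
is (1) by this second path (spread III `cmIdle_abelianSchemeVHC_of_denselyAnchored`). [cite: Deligne1982HodgeCycles,
Prop. 6.1 and Thm. 4.8 (pp. 50–51)] [cite: Andre1992HodgeCM] -/
theorem pivotAV_spreadZD_of_denselyAnchored (hF : deligne1982_cmDenseMumfordTateFamilies)
    (h𝔄 : Andre1992_hodgeClasses_cmAbelianVariety_mem_span_pullback_weilClasses)
    (hDq : DenselyAnchoredWeilFamiliesImaginaryQuadratic) (hDcm : DenselyAnchoredWeilFamiliesCMField) :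
    PivotAV SpreadFromZariskiDenseCMPoints ∧ PivotAV AbelianSchemeVHC :=
  ⟨⟨cmIdle_spreadZD hF h𝔄 hDq hDcm, onPathAV_spreadAxis.1⟩,
    ⟨cmIdle_abelianSchemeVHC_of_denselyAnchored hF h𝔄 hDq hDcm, onPathAV_abelianSchemeVHC_and_compactAbelianPencilVHC.1⟩⟩

/-! ## §2 Cross-branch edges WITHOUT `HC_CM` -/

/-- **Pencil ⟹ Mumford–Tate, granted refereed print only** (`h₂₁`, `h₂₂`): (2) gives S_ZD, U_Z, U and H4 — through
`HC_AV`; no direct comparison of the two classes of families is claimed (deform IV §D, same caveat).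
[cite: Andre1996Motifs, §6.3 Remarque 2 (p. 33)] [cite: CharlesSchnell2014Notes, Thm. 11.5.11 and Cor. 11.3.6] -/
theorem mtBranch_of_andre1996_of_compactAbelianPencilVHC (h₂₁ : andre1996_cmAnchoredPencil)
    (h₂₂ : andre1996_cmHodgeClasses_algebraicallyAnchoredPencils) (hV : CompactAbelianPencilVHC) :
    SpreadFromZariskiDenseCMPoints ∧ SpreadFromZariskiDenseCMLocus ∧ UniformAlgebraicityAtCMPoints ∧
      AlgebraicityLocusClosedOnCMDenseFamilies :=
  have hAV : HodgeAbelianVarieties := (cmIdle_blanket_of_andre1996 h₂₁ h₂₂).2.2.2.1 hV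
  ⟨onPathAV_spreadAxis.1 hAV, onPathAV_spreadAxis.2.1 hAV, onPathAV_spreadAxis.2.2 hAV, onPathAV_locusClosed hAV⟩

/-- The strict dominators of the pencil branch reach the Mumford–Tate branch likewise: (L∀) granted `h₂₁ h₂₂`
(abI `compactAbelianPencilVHC_of_algebraicFixedPart`), (5∀) granted `h₈ h₂₁ h₂₂` (andre III
`cmIdle_lefschetzBCompactPencils_of_abdulali_of_andre1996`). [cite: Andre1996Motifs, Remarque 2 (p. 33)]
[cite: Abdulali1994FamiliesAV, p. 1122] [cite: Milne2020HodgeClassesAV, Prop. 1 (p. 7) and Thm. 4 (p. 8)] -/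
theorem mtBranch_of_dominators (h₂₁ : andre1996_cmAnchoredPencil)
    (h₂₂ : andre1996_cmHodgeClasses_algebraicallyAnchoredPencils) :
    (AlgebraicFixedPart → SpreadFromZariskiDenseCMPoints ∧ UniformAlgebraicityAtCMPoints) ∧
      (Abdulali1994_invariantCycles_of_lefschetzStandard → LefschetzBCompactPencils →
        SpreadFromZariskiDenseCMPoints ∧ UniformAlgebraicityAtCMPoints) :=
  have hL : CMIdle AlgebraicFixedPart := (cmIdle_blanket_of_andre1996 h₂₁ h₂₂).2.2.2.2
  ⟨fun h ↦ ⟨onPathAV_spreadAxis.1 (hL h), onPathAV_spreadAxis.2.2 (hL h)⟩,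
    fun h₈ h ↦
      have hAV := cmIdle_lefschetzBCompactPencils_of_abdulali_of_andre1996 h₈ h₂₁ h₂₂ h
      ⟨onPathAV_spreadAxis.1 hAV, onPathAV_spreadAxis.2.2 hAV⟩⟩

/-- **Mumford–Tate ⟹ pencil, granted `hF`, `h𝔄` and the typed `DA_q`, `DA_K` (NO André 1996 binder)**: S_ZD gives
(1), (2), (3), R631, (4) and CPS_CM — through `HC_AV` (spread II `HC_AV_of_denselyAnchored_of_spreadZD`) and the
input-free ladder edges of part I / deform V, XIII. [cite: Deligne1982HodgeCycles, Thm. 4.8 (pp. 50–51)]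
[cite: Andre1992HodgeCM] -/
theorem pencilBranch_of_denselyAnchored_of_spreadZD (hF : deligne1982_cmDenseMumfordTateFamilies)
    (h𝔄 : Andre1992_hodgeClasses_cmAbelianVariety_mem_span_pullback_weilClasses)
    (hDq : DenselyAnchoredWeilFamiliesImaginaryQuadratic) (hDcm : DenselyAnchoredWeilFamiliesCMField)
    (hS : SpreadFromZariskiDenseCMPoints) :
    AbelianSchemeVHC ∧ CompactAbelianPencilVHC ∧ CMPointedCompactPencilVHC ∧ CMAnchoredPencilVHC ∧
      CMAnchoredTransport ∧ CMPointedPencilCMSpreading :=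
  have h1 : AbelianSchemeVHC :=
    onPathAV_abelianSchemeVHC_and_compactAbelianPencilVHC.1 (cmIdle_spreadZD hF h𝔄 hDq hDcm hS)
  have h2 : CompactAbelianPencilVHC := Deform.compactAbelianPencilVHC_of_abelianSchemeVHC h1
  have h3 : CMPointedCompactPencilVHC := Deform.cmPointedCompactPencilVHC_of_compactAbelianPencilVHC h2
  ⟨h1, h2, h3, Deform.cmAnchoredPencilVHC_of_cmPointedCompactPencilVHC h3,
    cmAnchoredTransport_of_cmPointedPencilVHC (cmPointedPencilVHC_iff_deform.2 h3),
    Deform.cmPointedPencilCMSpreading_of_compactAbelianPencilVHC h2⟩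

/-- … and with Lemme 6.3.1 also the two `h₂₁`-on-path floors (T∃) and CPS_∃ (part I `onPathAV_cmLocalised`, part II
`onPathAV_cmSpreading`). [cite: Andre1996Motifs, Lemme 6.3.1 (p. 31)] [cite: Deligne1982HodgeCycles, Prop. 6.1] -/
theorem pencilFloors_of_andre1996_of_denselyAnchored_of_spreadZD (h₂₁ : andre1996_cmAnchoredPencil)
    (hF : deligne1982_cmDenseMumfordTateFamilies)
    (h𝔄 : Andre1992_hodgeClasses_cmAbelianVariety_mem_span_pullback_weilClasses)
    (hDq : DenselyAnchoredWeilFamiliesImaginaryQuadratic) (hDcm : DenselyAnchoredWeilFamiliesCMField)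
    (hS : SpreadFromZariskiDenseCMPoints) : CMAnchoredPencilTransport ∧ CMAnchoredPencilCMSpreading :=
  have hAV : HodgeAbelianVarieties := cmIdle_spreadZD hF h𝔄 hDq hDcm hS
  ⟨(onPathAV_cmLocalised h₂₁).2.2.2 hAV, (onPathAV_cmSpreading h₂₁).2 hAV⟩

/-! ## §3 The pivot tier is one statement (no `HC_CM`); the complement tier is not -/

/-- **(2) ↔ S_ZD without `HC_CM`**, granted the union of the two input sets (`h₂₁ h₂₂` ∣ `hF h𝔄 DA_q DA_K`) — the two
branches' pivots are ONE statement, namely `HC_AV` (deform IV had `(1) ↔ (2) ↔ HC_AV` mod `h₂₁ h₂₂`, spread II had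
`HC_AV ↔ S_ZD` mod `hF h𝔄 DA_q DA_K`; compare part II `crossBranch_collapse_of_HC_CM`, which needed `HC_CM`).
[cite: Andre1996Motifs, §6.3 Remarque 2 (p. 33)] [cite: Deligne1982HodgeCycles, Thm. 4.8 (pp. 50–51)] -/
theorem compactAbelianPencilVHC_iff_spreadZD (h₂₁ : andre1996_cmAnchoredPencil)
    (h₂₂ : andre1996_cmHodgeClasses_algebraicallyAnchoredPencils) (hF : deligne1982_cmDenseMumfordTateFamilies)
    (h𝔄 : Andre1992_hodgeClasses_cmAbelianVariety_mem_span_pullback_weilClasses)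
    (hDq : DenselyAnchoredWeilFamiliesImaginaryQuadratic) (hDcm : DenselyAnchoredWeilFamiliesCMField) :
    (CompactAbelianPencilVHC ↔ SpreadFromZariskiDenseCMPoints) ∧
      (SpreadFromZariskiDenseCMPoints ↔ HodgeAbelianVarieties) :=
  have hS := (pivotAV_spreadZD_of_denselyAnchored hF h𝔄 hDq hDcm).1
  ⟨iff_of_pivotAV (pivotAV_pencilTop_of_andre1996 h₂₁ h₂₂).2 hS, pivotAV_iff.1 hS⟩

/-- **The complement tier without `HC_CM`: only relativised edges.** Between the proper complements of the two
branches the tree has `B → (HC_CM → B')` (part I `modCM_of_closesWithCM_of_onPathAV`), e.g. (T∃) ⟹ `ModCM U` with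
NO named fact, U ⟹ `ModCM (T∃)` granted `hF` (closing) and `h₂₁` (on-path), (5) ⟹ `ModCM U` granted `h₈ h₂₁`; an
`HC_CM`-free edge here in either direction is OPEN and claimed nowhere. [cite: Andre1996Motifs, Lemme 6.3.1 (p. 31)]
[cite: Deligne1982HodgeCycles, Prop. 6.1] [cite: Abdulali1994FamiliesAV, p. 1122] -/
theorem modCM_edges_of_complements (h₂₁ : andre1996_cmAnchoredPencil)
    (hF : deligne1982_cmDenseMumfordTateFamilies) :
    (CMAnchoredPencilTransport → ModCM UniformAlgebraicityAtCMPoints) ∧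
      (UniformAlgebraicityAtCMPoints → ModCM CMAnchoredPencilTransport) ∧
      (Abdulali1994_invariantCycles_of_lefschetzStandard → LefschetzBCMPointedPencils →
        ModCM UniformAlgebraicityAtCMPoints) :=
  ⟨modCM_of_closesWithCM_of_onPathAV closesWithCM_cmAnchoredPencilTransport onPathAV_spreadAxis.2.2,
    modCM_of_closesWithCM_of_onPathAV (closesWithCM_spreadAxis hF).2.2 (onPathAV_cmLocalised h₂₁).2.2.2,
    fun h₈ ↦ modCM_of_closesWithCM_of_onPathAV
      (closesWithCM_lefschetzBCMPointedPencils_of_abdulali_of_andre1996 h₈ h₂₁) onPathAV_spreadAxis.2.2⟩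

/-! ## Audit

Every theorem with a node, `HC_AV` or `HC_CM` in its conclusion has an OPEN statement among its hypotheses; `PivotAV`
is a predicate; `HC_CM` occurs only inside `ClosesWithCM` / `ModCM` / `CMIdle`-unbundling or as a conclusion drawn from
an open hypothesis. Nothing is decided; the item stmt-HodgeConjecture-16267 stays open. -/

/-- On-path audit: the summit gives every pivot with NO input at all (so the pivot tier is no stronger than the
target). [folklore] -/
theorem pivots_of_hodgeConjecture (hHC : _root_.HodgeConjecture) :
    AbelianSchemeVHC ∧ CompactAbelianPencilVHC ∧ SpreadFromZariskiDenseCMPoints :=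
  have hAV : HodgeAbelianVarieties := Deform.HC_AV_of_hodgeConjecture hHC
  ⟨onPathAV_abelianSchemeVHC_and_compactAbelianPencilVHC.1 hAV,
    onPathAV_abelianSchemeVHC_and_compactAbelianPencilVHC.2 hAV, onPathAV_spreadAxis.1 hAV⟩

end Summit.HodgeConjecture.HodgeConjecture.Ring2.AbelianAll
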